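import Literature.MathematicalPhysics.QuantumFieldTheory.Balaban1983to89.B9CubeLettersInvReadDict

/-!
# `Balaban1983to89.B9CubeLettersInvReadDictB` — T. Bałaban, *Propagators for lattice gauge theories in a background field*, Commun. Math. Phys.
# **99** (1985) 389–434 [Balaban1985BackgroundPropagators], Thm 3.3 p. 399 with (3.42) p. 397 READ over the gauge-invariant test class, BOND SECTOR:
# the (3.42) block of `kernelFamilyBInv` made POINTWISE for every test function, and the dictionary to def-Y's product-class reading
# `kernelFamilyB` (same constants) — the bond-sector twin of p21's `B9CubeLettersInvReadDict` §1–§3 (sub-row G-B9-LETTERS, DictB-READ)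

statement-level skeleton of published theorems with citation tags; proofs where landed; nothing here is a claim about the Yang–Mills mass gap

PDF held: `paper:balaban1985-cmp99-background-propagators` (journal page = PDF page + 388); pp. 397, 399 read from the held text layer.
p. 399: «Theorem 3.3. Under the assumptions of Theorem 3.1, and with the constants described there, the operator G(U) (a = 1) satisfies the
inequalities (3.42)–(3.47), with G′(U) replaced by G(U) and λ replaced by a function J defined at bonds of the lattice T_η or Ω₀, and with values
in g.»; p. 397 (3.42): «|(G′(U)λ)(x)|, |(∇_UG′(U)λ)(x)|, |(G′(U)∇*_Uλ)(x)|, |(Δ_UG′(U)λ)(x)| ≤ B₀[(Lʲη)², Lʲη, Lʲη, 1]e^{−δ₀d(y,y′)}|λ| for x∈Δ(y),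
y∈Λ_j, supp λ ⊂ Δ(y′)»; p. 397 (3.39): «|A| = max_μ sup_x |A_μ(x)|» (the sup over the 𝔤-valued test functions).

WHAT THIS FILE IS.  p21's `B9CubeLettersInvReadings.kernelFamilyBInv i B cfg O par` reads a bond-sector letter `O : BondOpY 𝔸 i` (G(U), 𝔾_D, G₁,
G(Ω) − G(Ω′), the cube letters G_□(U) of (3.100)) over print's class `TestY 𝔸 J = {Λ : ‖Λ(x)‖ ≤ |J(x)|}`; def-Y's `Node00.kernelFamilyB` reads it over
the product class `J ⊗ E`, `‖E‖ ≤ 1`.  This file is the READ half of the bond-sector dictionary: from the (3.42) block `EBlock (kernelFamilyBInv …) B₀ δ U₁`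
it extracts (§4) the four POINTWISE bounds for every member of the class — exactly the displayed hypotheses `h342₀` (value) and `h342₁` (gradient) of
this seat's E′₂b `B9Thm310CommutatorBound389B.norm_KhBY_O_hTY_apply_le` (§5 states them in that binder shape) — and (§3) the (3.42) block of def-Y's
product reading with the SAME constants.  The device (§1–§2) is p21's `norm_apply_le_of_testY` (generic in the carrier), used BY NAME on the fine-bond
carrier `FBondY i` with the ℝ-linear `cdBₗ ∕ cdsBₗ ∕ lapBₗ` of `B9CoReadingCoords`; corner-free members only (a section `ιB` of `β` is not even needed
for the READ direction).  The WRITE half (`…InvWriteDictB`) and the [4]-(2.51) majorants of the conj-`b` letters are the siblings' job (the latter is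
served, for the factors `K(h_□)G_□h_□`, by this seat's `B9Thm310CommutatorBound389BMajorant.hasMajorant_conj_of_ball_boundB`).

WHAT IS PROVED (all `theorem`s, 0 `def … : Prop`, 0 sorry).  §1 `norm_le_supInB`, `supInB_le`, `supInB_nonneg`, `le_iSup_fin`; §2 the four entries over
the class are uniformly bounded (`supInB_O_le_unif`, `iSup_supInB_cdB_O_le_unif`, `iSup_supInB_O_cdsB_le_unif`, `supInB_lapB_O_le_unif`) and
non-negative; §3 ★ `kernelFamilyB_e_le` (product entries ≤ class entries), ★ `eBlock_kernelFamilyB_of_eBlockInvB` (the block dictionary, same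
constants); §4 ★★ the four pointwise READ theorems `norm_O_le_of_eBlockInvB`, `norm_cdB_O_le_of_eBlockInvB`, `norm_O_cdsB_le_of_eBlockInvB`,
`norm_lapB_O_le_of_eBlockInvB`; §5 ★★ `h342₀_of_eBlockInvB`, `h342₁_of_eBlockInvB` (E′₂b's input shapes, verbatim), `h342₂_of_eBlockInvB`, `h342₃_of_eBlockInvB`.
HONEST SCOPE.  Bookkeeping only: nothing of Thm 3.3 ∕ 3.1 is asserted (the (3.42) block is the HYPOTHESIS `hE`); same rate `δ`; the basis `b` and its
coordinate bound `M₂` enter only the (finite-dimensional) boundedness of the class sups, never the constants; nothing continuum ∕ OS ∕ mass gap ∕ Clay;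
YM mass gap NOT proved by any of this (Track A conditional rung).  `--supports stmt-QuantumFields-19200`.  Net new unproved facts: 0.
-/

noncomputable section

namespace Literature.MathematicalPhysics.QuantumFieldTheory.Balaban1983to89.B9CubeLettersInvReadDictB

open Node00 B9CubeLettersInvReadings
open B9CubeLettersInvReadDict (le_iSup_testY iSup_testY_le norm_apply_le_of_testY)
open B6GlobalChartV1 (blkV1)
open B6Ineq2142KLevelV1 (β)
open B6KLevelCensusIndexV1 (KIdx)
open B9FromB6 (EBlock)
open B9GeoNormsKLevelV1 (geo9K)
open B9CoReadingCoords (cdBₗ cdsBₗ lapBₗ cdBₗ_apply cdsBₗ_apply lapBₗ_apply)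
open scoped Matrix

variable {d ℓ : ℕ} {hd : 1 ≤ d + 1} {hL : Odd (ℓ + 1) ∧ 1 < ℓ + 1} {b₀ b₁ : ℝ}
variable {𝔸 : Type} [NormedRing 𝔸] [NormedAlgebra ℂ 𝔸] [CompleteSpace 𝔸]
variable {ι : Type} [Fintype ι]
variable (i : KIdx d ℓ hd hL b₀ b₁) (b : Module.Basis ι ℝ 𝔸)

/-! ## §1 The block sup of the bond sector: `‖Ψ(x)‖ ≤ sup_{x ∈ Δ(y)} ‖Ψ‖`, and a pointwise bound ON the block bounds the sup -/

section Device

omit [NormedAlgebra ℂ 𝔸] [CompleteSpace 𝔸] [Fintype ι] in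
/-- a member of the block is dominated by the block sup. [cite: Balaban1985BackgroundPropagators, (3.42) p.397 («for x ∈ Δ(y)»), bookkeeping] -/
theorem norm_le_supInB (y : BlkY i) (Ψ : FBondY i → 𝔸) {x : FBondY i} (hx : blkV1 i.hN i.D x = y) : ‖Ψ x‖ ≤ supInB i y Ψ :=
  le_ciSup (f := fun x : {x : FBondY i // blkV1 i.hN i.D x = y} => ‖Ψ x.1‖) (Set.finite_range _).bddAbove ⟨x, hx⟩

omit [NormedAlgebra ℂ 𝔸] [CompleteSpace 𝔸] [Fintype ι] in
/-- a pointwise bound on the block (by a non-negative constant) bounds the block sup. [cite: Balaban1985BackgroundPropagators, (3.42) p.397, bookkeeping] -/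
theorem supInB_le (y : BlkY i) (Ψ : FBondY i → 𝔸) {c : ℝ} (hc : 0 ≤ c) (h : ∀ x : FBondY i, blkV1 i.hN i.D x = y → ‖Ψ x‖ ≤ c) :
    supInB i y Ψ ≤ c :=
  Real.iSup_le (fun x => h x.1 x.2) hc

omit [NormedAlgebra ℂ 𝔸] [CompleteSpace 𝔸] [Fintype ι] in
/-- the block sup is non-negative. [cite: Balaban1985BackgroundPropagators, (3.42) p.397, bookkeeping] -/
theorem supInB_nonneg (y : BlkY i) (Ψ : FBondY i → 𝔸) : 0 ≤ supInB i y Ψ := Real.iSup_nonneg fun _ => norm_nonneg _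

/-- a member of a finite family of reals is dominated by its sup (the `max_μ` of (3.39)). [cite: Balaban1985BackgroundPropagators, (3.39) p.397, bookkeeping] -/
theorem le_iSup_fin {n : ℕ} (F : Fin n → ℝ) (ν : Fin n) : F ν ≤ ⨆ ν', F ν' := le_ciSup (Set.finite_range _).bddAbove ν

end Device

/-! ## §2 The four (3.42) entries of a bond-sector letter over the class are bounded above (p21's device on the fine-bond carrier) -/

section Dominate

variable {M₂ : ℝ} (hM₂ : 0 ≤ M₂) (hrepr : ∀ (v : 𝔸) (j : ι), |b.repr v j| ≤ M₂ * ‖v‖)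
include hM₂ hrepr

omit [CompleteSpace 𝔸] in
omit hrepr in
/-- the uniform bound of p21's device is non-negative. [cite: Balaban1985BackgroundPropagators, (3.42) p.397, bookkeeping] -/
private theorem sum3B_nonneg (T : Module.End ℝ (FBondY i → 𝔸)) (J : FBondY i → ℝ) :
    0 ≤ M₂ * ∑ z, |J z| * ∑ j, ∑ w', ‖T (deltaY z (b j)) w'‖ :=
  mul_nonneg hM₂ (Finset.sum_nonneg fun _ _ => mul_nonneg (abs_nonneg _)
    (Finset.sum_nonneg fun _ _ => Finset.sum_nonneg fun _ _ => norm_nonneg _))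

/-- entry 0 (value) over the class is uniformly bounded. [cite: Balaban1985BackgroundPropagators, Thm 3.3 p.399 with (3.42) p.397 (first member), bookkeeping] -/
theorem supInB_O_le_unif (O : BondOpY 𝔸 i) (V : CfgY 𝔸 i) (J : FBondY i → ℝ) (Λ : TestY 𝔸 J) (y : BlkY i) :
    supInB i y (O V Λ.1) ≤ M₂ * ∑ z, |J z| * ∑ j, ∑ w', ‖((O V).restrictScalars ℝ) (deltaY z (b j)) w'‖ :=
  supInB_le i y _ (sum3B_nonneg i b hM₂ _ J) fun x _ => norm_apply_le_of_testY b ((O V).restrictScalars ℝ) hM₂ hrepr J Λ x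

/-- entry 1 (gradient of the value) over the class is uniformly bounded. [cite: Balaban1985BackgroundPropagators, Thm 3.3 p.399 with (3.42) p.397 (second member), bookkeeping] -/
theorem iSup_supInB_cdB_O_le_unif (O : BondOpY 𝔸 i) (V : CfgY 𝔸 i) (J : FBondY i → ℝ) (Λ : TestY 𝔸 J) (y : BlkY i) :
    (⨆ ν : Fin (d + 1), supInB i y (cdB i V ν (O V Λ.1))) ≤ ∑ ν : Fin (d + 1), M₂ * ∑ z, |J z| * ∑ j, ∑ w',
      ‖(cdBₗ i V ν ∘ₗ (O V).restrictScalars ℝ) (deltaY z (b j)) w'‖ :=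
  Real.iSup_le (fun ν => (supInB_le i y _ (sum3B_nonneg i b hM₂ _ J) fun x _ =>
      norm_apply_le_of_testY b (cdBₗ i V ν ∘ₗ (O V).restrictScalars ℝ) hM₂ hrepr J Λ x).trans
    (Finset.single_le_sum (f := fun ν : Fin (d + 1) => M₂ * ∑ z, |J z| * ∑ j, ∑ w',
      ‖(cdBₗ i V ν ∘ₗ (O V).restrictScalars ℝ) (deltaY z (b j)) w'‖) (fun _ _ => sum3B_nonneg i b hM₂ _ J) (Finset.mem_univ ν)))
    (Finset.sum_nonneg fun _ _ => sum3B_nonneg i b hM₂ _ J)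

/-- entry 2 (value of the divergence) over the class is uniformly bounded. [cite: Balaban1985BackgroundPropagators, Thm 3.3 p.399 with (3.42) p.397 (third member), bookkeeping] -/
theorem iSup_supInB_O_cdsB_le_unif (O : BondOpY 𝔸 i) (V : CfgY 𝔸 i) (J : FBondY i → ℝ) (Λ : TestY 𝔸 J) (y : BlkY i) :
    (⨆ ν : Fin (d + 1), supInB i y (O V (cdsB i V ν Λ.1))) ≤ ∑ ν : Fin (d + 1), M₂ * ∑ z, |J z| * ∑ j, ∑ w',
      ‖((O V).restrictScalars ℝ ∘ₗ cdsBₗ i V ν) (deltaY z (b j)) w'‖ :=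
  Real.iSup_le (fun ν => (supInB_le i y _ (sum3B_nonneg i b hM₂ _ J) fun x _ =>
      norm_apply_le_of_testY b ((O V).restrictScalars ℝ ∘ₗ cdsBₗ i V ν) hM₂ hrepr J Λ x).trans
    (Finset.single_le_sum (f := fun ν : Fin (d + 1) => M₂ * ∑ z, |J z| * ∑ j, ∑ w',
      ‖((O V).restrictScalars ℝ ∘ₗ cdsBₗ i V ν) (deltaY z (b j)) w'‖) (fun _ _ => sum3B_nonneg i b hM₂ _ J) (Finset.mem_univ ν)))
    (Finset.sum_nonneg fun _ _ => sum3B_nonneg i b hM₂ _ J)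

/-- entry 3 (Laplacian of the value) over the class is uniformly bounded. [cite: Balaban1985BackgroundPropagators, Thm 3.3 p.399 with (3.42) p.397 (fourth member), bookkeeping] -/
theorem supInB_lapB_O_le_unif (O : BondOpY 𝔸 i) (V : CfgY 𝔸 i) (J : FBondY i → ℝ) (Λ : TestY 𝔸 J) (y : BlkY i) :
    supInB i y (lapB i V (O V Λ.1)) ≤ M₂ * ∑ z, |J z| * ∑ j, ∑ w', ‖(lapBₗ i V ∘ₗ (O V).restrictScalars ℝ) (deltaY z (b j)) w'‖ :=
  supInB_le i y _ (sum3B_nonneg i b hM₂ _ J) fun x _ => by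
    have h := norm_apply_le_of_testY b (lapBₗ i V ∘ₗ (O V).restrictScalars ℝ) hM₂ hrepr J Λ x
    rw [LinearMap.comp_apply, lapBₗ_apply] at h
    exact h

variable (O : BondOpY 𝔸 i) {B : B9.Backgrounds} (cfg : B.Cfg → CfgY 𝔸 i) (par : BondParY 𝔸 i)

/-! ## §3 def-Y's product entries are dominated by the entries over the class; the block dictionary (same constants) -/

/-- ★ **def-Y's PRODUCT ENTRIES ARE DOMINATED BY THE ENTRIES OVER THE CLASS**, bond sector (`J ⊗ E ∈ TestY 𝔸 J` for `‖E‖ ≤ 1`; the class sup is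
bounded above by §2): `(kernelFamilyB …).e n U λ y ≤ (kernelFamilyBInv …).e n U λ y`. [cite: Balaban1985BackgroundPropagators, Thm 3.3 p.399 with (3.39) + (3.42) p.397] -/
theorem kernelFamilyB_e_le (n : Fin 4) (U : B.Cfg) (lam : (geo9K i).Loc) (y : (geo9K i).Site) :
    (kernelFamilyB i B cfg O par).e n U lam y ≤ (kernelFamilyBInv i B cfg O par).e n U lam y := by
  cases lam with
  | inl f => exact le_rfl
  | inr J =>
    fin_cases n
    · show (⨆ E : BallY 𝔸, supInB i (β i.hN i.D i.hk y) (O (cfg U) (liftY J (E : 𝔸)))) ≤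
        ⨆ Λ : TestY 𝔸 J, supInB i (β i.hN i.D i.hk y) (O (cfg U) Λ.1)
      exact iSup_ball_le (fun E => le_iSup_testY (fun Λ => supInB_O_le_unif i b hM₂ hrepr O (cfg U) J Λ _) (testYOfBall J E))
        (Real.iSup_nonneg fun Λ => supInB_nonneg i _ _)
    · show (⨆ E : BallY 𝔸, ⨆ ν : Fin (d + 1), supInB i (β i.hN i.D i.hk y) (cdB i (cfg U) ν (O (cfg U) (liftY J (E : 𝔸))))) ≤
        ⨆ Λ : TestY 𝔸 J, ⨆ ν : Fin (d + 1), supInB i (β i.hN i.D i.hk y) (cdB i (cfg U) ν (O (cfg U) Λ.1))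
      exact iSup_ball_le (fun E => le_iSup_testY (fun Λ => iSup_supInB_cdB_O_le_unif i b hM₂ hrepr O (cfg U) J Λ _) (testYOfBall J E))
        (Real.iSup_nonneg fun Λ => Real.iSup_nonneg fun ν => supInB_nonneg i _ _)
    · show (⨆ E : BallY 𝔸, ⨆ ν : Fin (d + 1), supInB i (β i.hN i.D i.hk y) (O (cfg U) (cdsB i (cfg U) ν (liftY J (E : 𝔸))))) ≤
        ⨆ Λ : TestY 𝔸 J, ⨆ ν : Fin (d + 1), supInB i (β i.hN i.D i.hk y) (O (cfg U) (cdsB i (cfg U) ν Λ.1))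
      exact iSup_ball_le (fun E => le_iSup_testY (fun Λ => iSup_supInB_O_cdsB_le_unif i b hM₂ hrepr O (cfg U) J Λ _) (testYOfBall J E))
        (Real.iSup_nonneg fun Λ => Real.iSup_nonneg fun ν => supInB_nonneg i _ _)
    · show (⨆ E : BallY 𝔸, supInB i (β i.hN i.D i.hk y) (lapB i (cfg U) (O (cfg U) (liftY J (E : 𝔸))))) ≤
        ⨆ Λ : TestY 𝔸 J, supInB i (β i.hN i.D i.hk y) (lapB i (cfg U) (O (cfg U) Λ.1))
      exact iSup_ball_le (fun E => le_iSup_testY (fun Λ => supInB_lapB_O_le_unif i b hM₂ hrepr O (cfg U) J Λ _) (testYOfBall J E))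
        (Real.iSup_nonneg fun Λ => supInB_nonneg i _ _)

/-- ★ **THE BLOCK DICTIONARY OF THE BOND SECTOR, SAME CONSTANTS**: the (3.42) block of the reading over the class gives the (3.42) block of def-Y's
product reading. [cite: Balaban1985BackgroundPropagators, Thm 3.3 p.399 with (3.42) p.397] -/
theorem eBlock_kernelFamilyB_of_eBlockInvB {B₀ δ : ℝ} {U₁ : B.Cfg} (hE : EBlock (kernelFamilyBInv i B cfg O par) B₀ δ U₁) :
    EBlock (kernelFamilyB i B cfg O par) B₀ δ U₁ :=
  fun n lam y y' hs => (kernelFamilyB_e_le i b hM₂ hrepr O cfg par n U₁ lam y).trans (hE n lam y y' hs)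

end Dominate

/-! ## §4 READ pointwise: the (3.42) block over the class bounds every test function of the class, at every bond of the block -/

section Read

variable {B : B9.Backgrounds} (cfg : B.Cfg → CfgY 𝔸 i) (O : BondOpY 𝔸 i) (par : BondParY 𝔸 i) {B₀ δ : ℝ} {U₁ : B.Cfg}

/-- ★★ entry 0 READ pointwise over the class: `‖(O(V)Λ)(x)‖ ≤ B₀ℓ(y)²e^{−δd(y,y′)}|J|` for every `Λ ∈ TestY 𝔸 J`, `supp J ⊂ Δ(βy′)`, `x ∈ Δ(βy)`
(`V = cfg U₁`). [cite: Balaban1985BackgroundPropagators, Thm 3.3 p.399 with (3.42) p.397 (first member)] -/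
theorem norm_O_le_of_eBlockInvB (hE : EBlock (kernelFamilyBInv i B cfg O par) B₀ δ U₁)
    {M₂ : ℝ} (hM₂ : 0 ≤ M₂) (hrepr : ∀ (v : 𝔸) (j : ι), |b.repr v j| ≤ M₂ * ‖v‖)
    (J : FBondY i → ℝ) (y y' : IBondY i) (hs : (geo9K i).suppIn (Sum.inr J) y') (Λ : TestY 𝔸 J)
    {x : FBondY i} (hx : blkV1 i.hN i.D x = β i.hN i.D i.hk y) :
    ‖O (cfg U₁) Λ.1 x‖ ≤ B₀ * (geo9K i).len y ^ 2 * Real.exp (-(δ * (geo9K i).dist y y')) * (geo9K i).supNorm (Sum.inr J) := by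
  have h := hE 0 (Sum.inr J) y y' hs
  have hK : (kernelFamilyBInv i B cfg O par).e 0 U₁ (Sum.inr J) y =
      ⨆ Λ' : TestY 𝔸 J, supInB i (β i.hN i.D i.hk y) (O (cfg U₁) Λ'.1) := rfl
  have hp : B9.pref4 ((geo9K i).len y) 0 = (geo9K i).len y ^ 2 := rfl
  rw [hK, hp] at h
  refine le_trans ?_ h
  exact (norm_le_supInB i _ (O (cfg U₁) Λ.1) hx).trans
    (le_iSup_testY (fun Λ' => supInB_O_le_unif i b hM₂ hrepr O (cfg U₁) J Λ' (β i.hN i.D i.hk y)) Λ)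

/-- ★★ entry 1 READ pointwise over the class: `‖(∇_{V,ν}O(V)Λ)(x)‖ ≤ B₀ℓ(y)e^{−δd(y,y′)}|J|`. [cite: Balaban1985BackgroundPropagators, Thm 3.3 p.399 with (3.42) p.397 (second member)] -/
theorem norm_cdB_O_le_of_eBlockInvB (hE : EBlock (kernelFamilyBInv i B cfg O par) B₀ δ U₁)
    {M₂ : ℝ} (hM₂ : 0 ≤ M₂) (hrepr : ∀ (v : 𝔸) (j : ι), |b.repr v j| ≤ M₂ * ‖v‖)
    (J : FBondY i → ℝ) (y y' : IBondY i) (hs : (geo9K i).suppIn (Sum.inr J) y') (Λ : TestY 𝔸 J)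
    {x : FBondY i} (ν : Fin (d + 1)) (hx : blkV1 i.hN i.D x = β i.hN i.D i.hk y) :
    ‖cdB i (cfg U₁) ν (O (cfg U₁) Λ.1) x‖ ≤ B₀ * (geo9K i).len y * Real.exp (-(δ * (geo9K i).dist y y')) * (geo9K i).supNorm (Sum.inr J) := by
  have h := hE 1 (Sum.inr J) y y' hs
  have hK : (kernelFamilyBInv i B cfg O par).e 1 U₁ (Sum.inr J) y =
      ⨆ Λ' : TestY 𝔸 J, ⨆ ν' : Fin (d + 1), supInB i (β i.hN i.D i.hk y) (cdB i (cfg U₁) ν' (O (cfg U₁) Λ'.1)) := rfl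
  have hp : B9.pref4 ((geo9K i).len y) 1 = (geo9K i).len y := rfl
  rw [hK, hp] at h
  refine le_trans ?_ h
  refine (norm_le_supInB i _ (cdB i (cfg U₁) ν (O (cfg U₁) Λ.1)) hx).trans ?_
  refine (le_iSup_fin (fun ν' : Fin (d + 1) => supInB i (β i.hN i.D i.hk y) (cdB i (cfg U₁) ν' (O (cfg U₁) Λ.1))) ν).trans ?_
  exact le_iSup_testY (fun Λ' => iSup_supInB_cdB_O_le_unif i b hM₂ hrepr O (cfg U₁) J Λ' (β i.hN i.D i.hk y)) Λ

/-- ★★ entry 2 READ pointwise over the class: `‖(O(V)∇*_{V,ν}Λ)(x)‖ ≤ B₀ℓ(y)e^{−δd(y,y′)}|J|`. [cite: Balaban1985BackgroundPropagators, Thm 3.3 p.399 with (3.42) p.397 (third member)] -/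
theorem norm_O_cdsB_le_of_eBlockInvB (hE : EBlock (kernelFamilyBInv i B cfg O par) B₀ δ U₁)
    {M₂ : ℝ} (hM₂ : 0 ≤ M₂) (hrepr : ∀ (v : 𝔸) (j : ι), |b.repr v j| ≤ M₂ * ‖v‖)
    (J : FBondY i → ℝ) (y y' : IBondY i) (hs : (geo9K i).suppIn (Sum.inr J) y') (Λ : TestY 𝔸 J)
    {x : FBondY i} (ν : Fin (d + 1)) (hx : blkV1 i.hN i.D x = β i.hN i.D i.hk y) :
    ‖O (cfg U₁) (cdsB i (cfg U₁) ν Λ.1) x‖ ≤ B₀ * (geo9K i).len y * Real.exp (-(δ * (geo9K i).dist y y')) * (geo9K i).supNorm (Sum.inr J) := by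
  have h := hE 2 (Sum.inr J) y y' hs
  have hK : (kernelFamilyBInv i B cfg O par).e 2 U₁ (Sum.inr J) y =
      ⨆ Λ' : TestY 𝔸 J, ⨆ ν' : Fin (d + 1), supInB i (β i.hN i.D i.hk y) (O (cfg U₁) (cdsB i (cfg U₁) ν' Λ'.1)) := rfl
  have hp : B9.pref4 ((geo9K i).len y) 2 = (geo9K i).len y := rfl
  rw [hK, hp] at h
  refine le_trans ?_ h
  refine (norm_le_supInB i _ (O (cfg U₁) (cdsB i (cfg U₁) ν Λ.1)) hx).trans ?_
  refine (le_iSup_fin (fun ν' : Fin (d + 1) => supInB i (β i.hN i.D i.hk y) (O (cfg U₁) (cdsB i (cfg U₁) ν' Λ.1))) ν).trans ?_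
  exact le_iSup_testY (fun Λ' => iSup_supInB_O_cdsB_le_unif i b hM₂ hrepr O (cfg U₁) J Λ' (β i.hN i.D i.hk y)) Λ

/-- ★★ entry 3 READ pointwise over the class: `‖(Δ_V O(V)Λ)(x)‖ ≤ B₀e^{−δd(y,y′)}|J|`. [cite: Balaban1985BackgroundPropagators, Thm 3.3 p.399 with (3.42) p.397 (fourth member)] -/
theorem norm_lapB_O_le_of_eBlockInvB (hE : EBlock (kernelFamilyBInv i B cfg O par) B₀ δ U₁)
    {M₂ : ℝ} (hM₂ : 0 ≤ M₂) (hrepr : ∀ (v : 𝔸) (j : ι), |b.repr v j| ≤ M₂ * ‖v‖)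
    (J : FBondY i → ℝ) (y y' : IBondY i) (hs : (geo9K i).suppIn (Sum.inr J) y') (Λ : TestY 𝔸 J)
    {x : FBondY i} (hx : blkV1 i.hN i.D x = β i.hN i.D i.hk y) :
    ‖lapB i (cfg U₁) (O (cfg U₁) Λ.1) x‖ ≤ B₀ * 1 * Real.exp (-(δ * (geo9K i).dist y y')) * (geo9K i).supNorm (Sum.inr J) := by
  have h := hE 3 (Sum.inr J) y y' hs
  have hK : (kernelFamilyBInv i B cfg O par).e 3 U₁ (Sum.inr J) y =
      ⨆ Λ' : TestY 𝔸 J, supInB i (β i.hN i.D i.hk y) (lapB i (cfg U₁) (O (cfg U₁) Λ'.1)) := rfl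
  have hp : B9.pref4 ((geo9K i).len y) 3 = 1 := rfl
  rw [hK, hp] at h
  refine le_trans ?_ h
  exact (norm_le_supInB i _ (lapB i (cfg U₁) (O (cfg U₁) Λ.1)) hx).trans
    (le_iSup_testY (fun Λ' => supInB_lapB_O_le_unif i b hM₂ hrepr O (cfg U₁) J Λ' (β i.hN i.D i.hk y)) Λ)

/-! ## §5 The READ in the binder shapes of E′₂b's `B9Thm310CommutatorBound389B.norm_KhBY_O_hTY_apply_le` (`O := O (cfg U₁)`, `U := cfg U₁`) -/

/-- ★★ **THE VALUE INPUT `h342₀` OF THE BOND-SECTOR (3.89) BOUND**, served from the (3.42) block over the class: for every profile `J` with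
`supp J ⊂ Δ(βy′)`, every `Λ` with `‖Λ(x)‖ ≤ |J(x)|` and every `x ∈ Δ(βy)`, `‖(O(V)Λ)(x)‖ ≤ B₀ℓ(y)²e^{−δd(y,y′)}|J|`.
[cite: Balaban1985BackgroundPropagators, Thm 3.3 p.399 with (3.42) p.397 (first member); (3.89) p.409 (its use)] -/
theorem h342₀_of_eBlockInvB (hE : EBlock (kernelFamilyBInv i B cfg O par) B₀ δ U₁)
    {M₂ : ℝ} (hM₂ : 0 ≤ M₂) (hrepr : ∀ (v : 𝔸) (j : ι), |b.repr v j| ≤ M₂ * ‖v‖) :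
    ∀ (J : FBondY i → ℝ) (y y' : IBondY i), (geo9K i).suppIn (Sum.inr J) y' →
      ∀ Λ : FBondY i → 𝔸, (∀ x, ‖Λ x‖ ≤ |J x|) → ∀ x : FBondY i, blkV1 i.hN i.D x = β i.hN i.D i.hk y →
        ‖O (cfg U₁) Λ x‖ ≤ B₀ * (geo9K i).len y ^ 2 * Real.exp (-(δ * (geo9K i).dist y y')) * (geo9K i).supNorm (Sum.inr J) :=
  fun J y y' hs Λ hΛ _ hx => norm_O_le_of_eBlockInvB i b cfg O par hE hM₂ hrepr J y y' hs ⟨Λ, hΛ⟩ hx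

/-- ★★ **THE GRADIENT INPUT `h342₁` OF THE BOND-SECTOR (3.89) BOUND**, served from the (3.42) block over the class:
`‖(∇_{V,ν}O(V)Λ)(x)‖ ≤ B₀ℓ(y)e^{−δd(y,y′)}|J|`. [cite: Balaban1985BackgroundPropagators, Thm 3.3 p.399 with (3.42) p.397 (second member); (3.89) p.409 (its use)] -/
theorem h342₁_of_eBlockInvB (hE : EBlock (kernelFamilyBInv i B cfg O par) B₀ δ U₁)
    {M₂ : ℝ} (hM₂ : 0 ≤ M₂) (hrepr : ∀ (v : 𝔸) (j : ι), |b.repr v j| ≤ M₂ * ‖v‖) :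
    ∀ (J : FBondY i → ℝ) (y y' : IBondY i), (geo9K i).suppIn (Sum.inr J) y' →
      ∀ Λ : FBondY i → 𝔸, (∀ x, ‖Λ x‖ ≤ |J x|) → ∀ (x : FBondY i) (ν : Fin (d + 1)), blkV1 i.hN i.D x = β i.hN i.D i.hk y →
        ‖cdB i (cfg U₁) ν (O (cfg U₁) Λ) x‖ ≤ B₀ * (geo9K i).len y * Real.exp (-(δ * (geo9K i).dist y y')) * (geo9K i).supNorm (Sum.inr J) :=
  fun J y y' hs Λ hΛ _ ν hx => norm_cdB_O_le_of_eBlockInvB i b cfg O par hE hM₂ hrepr J y y' hs ⟨Λ, hΛ⟩ ν hx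

/-- the divergence input in the same binder shape: `‖(O(V)∇*_{V,ν}Λ)(x)‖ ≤ B₀ℓ(y)e^{−δd(y,y′)}|J|`.
[cite: Balaban1985BackgroundPropagators, Thm 3.3 p.399 with (3.42) p.397 (third member)] -/
theorem h342₂_of_eBlockInvB (hE : EBlock (kernelFamilyBInv i B cfg O par) B₀ δ U₁)
    {M₂ : ℝ} (hM₂ : 0 ≤ M₂) (hrepr : ∀ (v : 𝔸) (j : ι), |b.repr v j| ≤ M₂ * ‖v‖) :
    ∀ (J : FBondY i → ℝ) (y y' : IBondY i), (geo9K i).suppIn (Sum.inr J) y' →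
      ∀ Λ : FBondY i → 𝔸, (∀ x, ‖Λ x‖ ≤ |J x|) → ∀ (x : FBondY i) (ν : Fin (d + 1)), blkV1 i.hN i.D x = β i.hN i.D i.hk y →
        ‖O (cfg U₁) (cdsB i (cfg U₁) ν Λ) x‖ ≤ B₀ * (geo9K i).len y * Real.exp (-(δ * (geo9K i).dist y y')) * (geo9K i).supNorm (Sum.inr J) :=
  fun J y y' hs Λ hΛ _ ν hx => norm_O_cdsB_le_of_eBlockInvB i b cfg O par hE hM₂ hrepr J y y' hs ⟨Λ, hΛ⟩ ν hx

/-- the Laplacian input in the same binder shape: `‖(Δ_V O(V)Λ)(x)‖ ≤ B₀e^{−δd(y,y′)}|J|`.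
[cite: Balaban1985BackgroundPropagators, Thm 3.3 p.399 with (3.42) p.397 (fourth member)] -/
theorem h342₃_of_eBlockInvB (hE : EBlock (kernelFamilyBInv i B cfg O par) B₀ δ U₁)
    {M₂ : ℝ} (hM₂ : 0 ≤ M₂) (hrepr : ∀ (v : 𝔸) (j : ι), |b.repr v j| ≤ M₂ * ‖v‖) :
    ∀ (J : FBondY i → ℝ) (y y' : IBondY i), (geo9K i).suppIn (Sum.inr J) y' →
      ∀ Λ : FBondY i → 𝔸, (∀ x, ‖Λ x‖ ≤ |J x|) → ∀ x : FBondY i, blkV1 i.hN i.D x = β i.hN i.D i.hk y →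
        ‖lapB i (cfg U₁) (O (cfg U₁) Λ) x‖ ≤ B₀ * Real.exp (-(δ * (geo9K i).dist y y')) * (geo9K i).supNorm (Sum.inr J) :=
  fun J y y' hs Λ hΛ _ hx => by
    have h := norm_lapB_O_le_of_eBlockInvB i b cfg O par hE hM₂ hrepr J y y' hs ⟨Λ, hΛ⟩ hx
    rw [mul_one] at h
    exact h

end Read

end Literature.MathematicalPhysics.QuantumFieldTheory.Balaban1983to89.B9CubeLettersInvReadDictB

end
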